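import Summits.BirchSwinnertonDyer.BirchSwinnertonDyer.Theorems.UniversalToricDescentSigmaLocalTransport
import Summits.BirchSwinnertonDyer.BirchSwinnertonDyer.Theorems.UniversalToricDescentSigmaLocalSurjectiveAnyTorsion
import HarnessLib

/-!
# Route UniversalToricDescent — the algebraic `Σ`-Euler factors WITHOUT (iv):
# `#(Sel_𝔭^{Σ₀∪T}/Sel_𝔭^{Σ₀})[p] = ∏_{v∈T} (#H¹(H ∩ D_v, E[p^∞])[p])^{p^{c_v}}` from Poitou–Tate ×2 and base
# finiteness alone (Greenberg–Vatsal (2.10); port of `…SigmaLocalIndex` / `…SigmaLocalProduct` / `…SigmaLocalTransport`)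

Lead prover bsd-wall-utd-p1 g13 (`--supports` ♭T′ stmt-BirchSwinnertonDyer-26975; item (M0) of stub B′
`stub_lambdaTransportPT`, file 3/3). g8's chain `natCard_quotient_pTorsion_eq_pow` → `selmerAc_divisible_of_finite_pTorsion`
→ `natCard_quotient_pTorsion_eq_prod(_of_finite)` → `natCard_quotient_pTorsion_baseChange_eq_prod_of_noPTorsionPadic`
threads the hypothesis (iv) `E[p^∞]^{Γ_{K_𝔭}} = 0` only into the two Poitou–Tate surgery steps now available in
killing-exponent form (`…SigmaCoinvariantsAnyTorsion`, `…SigmaLocalSurjectiveAnyTorsion`). This file re-derives the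
chain on that input, proofs VERBATIM:

* §1 `natCard_quotient_pTorsion_eq_pow_anyTorsion` — `Sel^{Σ∪{v}}/Sel^Σ ≅ H¹(H ∩ D_v, E[p^∞])^{p^c}` and its
  `#[p]`-count;
* §2 `selmerAc_divisible_of_finite_pTorsion_anyTorsion` — `Sel^S = p·Sel^S` when `Sel^S[p]` is finite;
* §3 `natCard_quotient_pTorsion_eq_prod_anyTorsion`, `…_of_finite_anyTorsion` — the product over `T`;
* §4 **`natCard_quotient_pTorsion_baseChange_eq_prod_anyTorsion`** — the route's instance for `E/ℚ` over an
  imaginary quadratic `K` with `p` split, a degree-one strict place `𝔭 ∋ p`, ANY `ℤ_p`-extension, from Poitou–Tate ×2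
  and `Sel_v(K, E[p^∞])` finite at both `v ∣ p` — i.e. g8's `natCard_quotient_pTorsion_baseChange_eq_prod_of_noPTorsionPadic`
  with its hypothesis `h4 : E(ℚ_p)[p] = 0` DELETED. In stub B′ of ♭T′ this is the wild curve's `Σ`-product
  `#(Sel^Σ/Sel^∅)(E)[3] = ∏_v (#H¹(kerD κ v, E[3^∞])[3])^{3^{c_v}}` on ALL 2 023 habitat classes (206 of which fail (iv)).

HONEST STATUS: helper theorems, CONDITIONAL on the cited Poitou–Tate facts; (M1)–(M3) of stub B′ remain. THEOREMS
ONLY; no definition, no named fact, no `sorry`. BSD is not advanced by this file. References: [GreenbergVatsal2000]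
§2 (2.3), (2.4), (2.8), (2.10); [JetchevSkinnerWan2017] Prop. 3.3.2, Lemma 3.3.3; [MilneADT2006] I 2.8, 4.10.
-/

set_option autoImplicit false
-- `…BirchSwinnertonDyer.BirchSwinnertonDyer.Theorems…` is the problem's mandated namespace (D-0017).
set_option linter.dupNamespace false

noncomputable section
open scoped Classical
namespace Summit.BirchSwinnertonDyer.BirchSwinnertonDyer.Theorems.UniversalToricDescentSigmaLocalImage

open CategoryTheory Function Field NumberField IsDedekindDomain WeierstrassCurve
open Literature.NumberTheory.GaloisRepresentations Literature.NumberTheory.EllipticCurves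
  Literature.NumberTheory.EllipticCurves.GreenbergSelmer Literature.NumberTheory.GaloisCohomology
  Literature.NumberTheory.EllipticCurves.Rank1Residual
  Summit.BirchSwinnertonDyer.Rank1Residual Summit.BirchSwinnertonDyer.Rank1Residual.X11b
  Summit.BirchSwinnertonDyer.Rank1Residual.X11b.Coinv Summit.BirchSwinnertonDyer.Rank1Residual.X11b.LocBridge
  Summit.BirchSwinnertonDyer.Rank1Residual.X11b.AcSelmer Summit.BirchSwinnertonDyer.Rank1Residual.X11b.H2Support
  Summit.BirchSwinnertonDyer.Rank1Residual.X11b.Levels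
  Summit.BirchSwinnertonDyer.BirchSwinnertonDyer.Theorems.UniversalToricDescentSigmaCoinvariants
  Summit.BirchSwinnertonDyer.BirchSwinnertonDyer.Theorems.UniversalToricDescentSigmaLocalStabilizer
open Summit.BirchSwinnertonDyer.Rank1Residual.X11b.ProcyclicDescent (kerK)
open Literature.NumberTheory.EllipticCurves.IwasawaAlgebra Summit.BirchSwinnertonDyer.Rank1Residual.Iwasawa
  Summit.BirchSwinnertonDyer.BirchSwinnertonDyer.Theorems.UniversalToricDescentSigmaFree
  Summit.BirchSwinnertonDyer.BirchSwinnertonDyer.Theorems.UniversalToricDescentAcDualMuZero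
  Summit.BirchSwinnertonDyer.BirchSwinnertonDyer.Theorems.UniversalToricDescentNoFiniteSubmodule
  Summit.BirchSwinnertonDyer.BirchSwinnertonDyer.Theorems.SchneiderFreeAdditiveX3

section Selmer

variable {K : Type} [Field K] [NumberField K] (W : WeierstrassCurve K) [W.IsElliptic] (p : ℕ)
  [Fact p.Prime] (κ : ZpExtension K p)

/-! ### §1 The one-place count WITHOUT (iv): `Sel^{Σ∪{v}}/Sel^Σ ≅ H¹(H ∩ D_v, E[p^∞])^{p^c}` -/

/-- **`Sel_𝔭^{Σ∪{v}}(K_∞, E[p^∞]) / Sel_𝔭^Σ ≅ H¹(H ∩ D_v, E[p^∞])^{p^c}` and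
`#(Sel^{Σ∪{v}}/Sel^Σ)[p] = (#H¹(H ∩ D_v, E[p^∞])[p])^{p^c}`** (`Nat.card`), for `v ∤ p`, `v ∉ Σ`, with the
exact index `κ(D_v) = p^c ℤ_p` (every `p^c z` is a value on `D_v` and `p^c` divides every value) and the
hypotheses of the (iv)-free surjectivity theorem `exists_mem_selmerAc_insert_forall_resKerD_conjH1_eq_anyTorsion`. The evaluation `s ↦ (res_{H∩D_v}(conj_{γ^i} s))_{i<p^c}` is onto
(a tuple `(f_i)` extends to the equivariant function `d γ^i h ↦ conj_d f_i`, well defined because the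
cosets `D_v γ^i H`, `i < p^c`, are distinct and `H ∩ D_v` acts trivially) with kernel `Sel^Σ` (§1 after
`Γ_K = D_v γ^{<p^c} H`). [cite: GreenbergVatsal2000, §2 Cor. (2.3), Prop. (2.4) and (2.10) (pp. 24–28)]
[cite: Castella2018, Def. 2.2 (arXiv:1704.06608 p. 5)] -/
theorem natCard_quotient_pTorsion_eq_pow_anyTorsion [IsTotallyComplex K]
    (hPT : poitouTate_selmerStructure_duality K)
    (hEP : ∀ v : HeightOneSpectrum (𝓞 K), localEulerPoincareCharacteristic (v.adicCompletion K))
    {𝔭 𝔮 : HeightOneSpectrum (𝓞 K)} (h𝔭 : ((p : ℕ) : 𝓞 K) ∈ 𝔭.asIdeal)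
    (h𝔮 : ((p : ℕ) : 𝓞 K) ∈ 𝔮.asIdeal) (hne : 𝔮 ≠ 𝔭)
    {m : ℕ} (htor𝔮 : ∀ Q : W.geomPrimaryTorsion p, (∀ d ∈ decomp 𝔮, d • Q = Q) → p ^ m • Q = 0)
    (hfin : Finite (selmerAcBase W p 𝔮 ∅))
    (h2 : Subsingleton (galoisCohomology (primaryGaloisModule W p) 2))
    {γ : absoluteGaloisGroup K} (hγ : κ.IsTopGenerator γ) {S : Set (HeightOneSpectrum (𝓞 K))}
    {v : HeightOneSpectrum (𝓞 K)} (hpv : ((p : ℕ) : 𝓞 K) ∉ v.asIdeal) (hvS : v ∉ S) {c : ℕ}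
    (hc : ∀ z : ℤ_[p], ∃ d : decomp (K := K) v,
      (κ (d : absoluteGaloisGroup K)).toAdd = (p : ℤ_[p]) ^ c * z)
    (hle : ∀ d : decomp (K := K) v, (p : ℤ_[p]) ^ c ∣ (κ (d : absoluteGaloisGroup K)).toAdd) :
    Nonempty ((selmerAc W p κ 𝔭 (insert v S) ⧸
        (selmerAc W p κ 𝔭 S).addSubgroupOf (selmerAc W p κ 𝔭 (insert v S))) ≃+
        (Fin (p ^ c) → subgroupH1 (kerD κ v) (W.geomPrimaryTorsion p))) ∧
      Nat.card {b : selmerAc W p κ 𝔭 (insert v S) ⧸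
          (selmerAc W p κ 𝔭 S).addSubgroupOf (selmerAc W p κ 𝔭 (insert v S)) // p • b = 0} =
        Nat.card {f : subgroupH1 (kerD κ v) (W.geomPrimaryTorsion p) // p • f = 0} ^ (p ^ c) := by
  set H := κ.kerSubgroup with hH
  -- `v` is finitely decomposed: `κ d₁ = p^c ≠ 0`
  have hv : ¬ (decomp v ≤ H) := by
    obtain ⟨d₁, hd₁⟩ := hc 1
    intro hle'
    have h1 : κ (d₁ : absoluteGaloisGroup K) = 1 := (ZpExtension.mem_kerSubgroup).mp (hle' d₁.2)
    rw [h1, toAdd_one, mul_one] at hd₁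
    exact (pow_ne_zero c (Nat.cast_ne_zero.mpr (Fact.out : p.Prime).ne_zero)) hd₁.symm
  -- the evaluation map
  let Ψ : selmerAc W p κ 𝔭 (insert v S) →+ (Fin (p ^ c) → subgroupH1 (kerD κ v) (W.geomPrimaryTorsion p)) :=
    { toFun := fun s i ↦ resKerD κ (W.geomPrimaryTorsion p) v (W.conjH1 p H (γ ^ (i : ℕ)) s)
      map_zero' := funext fun i ↦ by simp
      map_add' := fun a b ↦ funext fun i ↦ by simp }
  have hΨapply : ∀ (s : selmerAc W p κ 𝔭 (insert v S)) (i : Fin (p ^ c)),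
      Ψ s i = resKerD κ (W.geomPrimaryTorsion p) v (W.conjH1 p H (γ ^ (i : ℕ)) s) := fun _ _ ↦ rfl
  -- signatures are right-`H`-invariant and left-`D_v`-equivariant
  have hsig : ∀ (x : W.subgroupH1 p H) (d : decomp (K := K) v) (σ h : absoluteGaloisGroup K), h ∈ H →
      resKerD κ (W.geomPrimaryTorsion p) v (W.conjH1 p H ((d : absoluteGaloisGroup K) * σ * h) x) =
        conjH1 (kerD κ v) (W.geomPrimaryTorsion p) d
          (resKerD κ (W.geomPrimaryTorsion p) v (W.conjH1 p H σ x)) := by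
    intro x d σ h hh
    rw [W.conjH1_mul_holds p H, AddMonoidHom.comp_apply, W.conjH1_of_mem_holds p H hh,
      AddMonoidHom.id_apply, W.conjH1_mul_holds p H, AddMonoidHom.comp_apply, resKerD_conjH1]
  -- (i) the kernel of `Ψ` is `Sel^Σ`
  have hker : Ψ.ker = (selmerAc W p κ 𝔭 S).addSubgroupOf (selmerAc W p κ 𝔭 (insert v S)) := by
    ext s
    rw [AddMonoidHom.mem_ker, AddSubgroup.mem_addSubgroupOf,
      ← forall_resKerD_conjH1_eq_zero_iff_mem_selmerAc W p κ hpv hvS s.2]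
    constructor
    · intro h0 σ
      obtain ⟨d, n, h, hn, hh, rfl⟩ := exists_decomp_mul_pow_lt_mul_mem_ker κ hγ v hc σ
      rw [hsig _ d _ h hh, ← hΨapply s ⟨n, hn⟩, h0, Pi.zero_apply, map_zero]
    · intro h0
      funext i
      rw [hΨapply, h0, Pi.zero_apply]
  -- (ii) `Ψ` is onto
  have hsurj : Function.Surjective Ψ := by
    intro f
    -- the decomposition `σ = d(σ) γ^{n(σ)} h(σ)`
    choose dσ nσ hσ hnσ hhσ heσ using exists_decomp_mul_pow_lt_mul_mem_ker κ hγ v hc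
    -- `conj_d` only depends on `d` modulo `H ∩ D_v`
    have hconj : ∀ (d d' : decomp (K := K) v) (x : subgroupH1 (kerD κ v) (W.geomPrimaryTorsion p)),
        ((d⁻¹ * d' : decomp (K := K) v) : absoluteGaloisGroup K) ∈ H →
        conjH1 (kerD κ v) (W.geomPrimaryTorsion p) d' x =
          conjH1 (kerD κ v) (W.geomPrimaryTorsion p) d x := by
      intro d d' x hmem
      conv_lhs => rw [← mul_inv_cancel_left d d', conjH1_mul_holds (kerD κ v),
        AddMonoidHom.comp_apply, conjH1_of_mem_holds (kerD κ v) _ ((mem_kerD_iff κ v _).2 hmem),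
        AddMonoidHom.id_apply]
    -- uniqueness of the decomposition
    have huniq : ∀ (d d' : decomp (K := K) v) (i j : ℕ) (h h' : absoluteGaloisGroup K),
        i < p ^ c → j < p ^ c → h ∈ H → h' ∈ H →
        (d : absoluteGaloisGroup K) * γ ^ i * h = (d' : absoluteGaloisGroup K) * γ ^ j * h' →
        i = j ∧ ((d'⁻¹ * d : decomp (K := K) v) : absoluteGaloisGroup K) ∈ H := by
      intro d d' i j h h' hi hj hh hh' e
      have hij := eq_of_decomp_mul_pow_mul_eq κ hγ v hle hi hj hh hh' e
      subst hij
      refine ⟨rfl, ?_⟩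
      have e' : ((d'⁻¹ * d : decomp (K := K) v) : absoluteGaloisGroup K) =
          γ ^ i * (h' * h⁻¹) * (γ ^ i)⁻¹ := by
        have e2 : (d : absoluteGaloisGroup K) =
            (d' : absoluteGaloisGroup K) * γ ^ i * h' * h⁻¹ * (γ ^ i)⁻¹ := by
          rw [← e]; group
        rw [Subgroup.coe_mul, Subgroup.coe_inv, e2]
        group
      rw [e']
      exact Subgroup.Normal.conj_mem inferInstance _ (H.mul_mem hh' (H.inv_mem hh)) _
    let F : absoluteGaloisGroup K → subgroupH1 (kerD κ v) (W.geomPrimaryTorsion p) :=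
      fun σ ↦ conjH1 (kerD κ v) (W.geomPrimaryTorsion p) (dσ σ) (f ⟨nσ σ, hnσ σ⟩)
    have hFapply : ∀ σ, F σ = conjH1 (kerD κ v) (W.geomPrimaryTorsion p) (dσ σ) (f ⟨nσ σ, hnσ σ⟩) :=
      fun _ ↦ rfl
    -- `F(d γ^i h) = conj_d (f i)`
    have hFval : ∀ (d : decomp (K := K) v) (i : ℕ) (hi : i < p ^ c) (h : absoluteGaloisGroup K),
        h ∈ H → F ((d : absoluteGaloisGroup K) * γ ^ i * h) =
          conjH1 (kerD κ v) (W.geomPrimaryTorsion p) d (f ⟨i, hi⟩) := by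
      intro d i hi h hh
      set σ := (d : absoluteGaloisGroup K) * γ ^ i * h with hσdef
      obtain ⟨hij, hmem⟩ := huniq d (dσ σ) i (nσ σ) h (hσ σ) hi (hnσ σ) hh (hhσ σ) (heσ σ)
      rw [hFapply, hconj d (dσ σ) _ ?_]
      · congr 2
        exact Fin.ext hij.symm
      · -- `d⁻¹ dσ ∈ H` from `(dσ)⁻¹ d ∈ H`
        have := H.inv_mem hmem
        rwa [← Subgroup.coe_inv, mul_inv_rev, inv_inv] at this
    have hFH : ∀ (σ h : absoluteGaloisGroup K), h ∈ H → F (σ * h) = F σ := by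
      intro σ h hh
      conv_lhs => rw [heσ σ, mul_assoc, hFval (dσ σ) (nσ σ) (hnσ σ) _ (H.mul_mem (hhσ σ) hh)]
    have hFD : ∀ (d : decomp (K := K) v) (σ : absoluteGaloisGroup K),
        F ((d : absoluteGaloisGroup K) * σ) =
          conjH1 (kerD κ v) (W.geomPrimaryTorsion p) d (F σ) := by
      intro d σ
      conv_lhs => rw [heσ σ, ← mul_assoc, ← mul_assoc, ← Subgroup.coe_mul,
        hFval (d * dσ σ) (nσ σ) (hnσ σ) _ (hhσ σ)]
      rw [conjH1_mul_holds (kerD κ v), AddMonoidHom.comp_apply, hFapply]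
    obtain ⟨s, hs, hsF⟩ := exists_mem_selmerAc_insert_forall_resKerD_conjH1_eq_anyTorsion W p κ hPT hEP h𝔭
      h𝔮 hne htor𝔮 hfin h2 hγ S hpv hv F hFH hFD
    refine ⟨⟨s, hs⟩, funext fun i ↦ ?_⟩
    obtain ⟨i, hi⟩ := i
    rw [hΨapply]
    change resKerD κ (W.geomPrimaryTorsion p) v (W.conjH1 p H (γ ^ i) s) = f ⟨i, hi⟩
    rw [hsF, show γ ^ i = ((1 : decomp (K := K) v) : absoluteGaloisGroup K) * γ ^ i * 1 by
      rw [Subgroup.coe_one, one_mul, mul_one], hFval 1 i hi 1 H.one_mem,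
      Literature.NumberTheory.EllipticCurves.conjH1_one_holds (kerD κ v), AddMonoidHom.id_apply]
  -- (iii) the isomorphism and the count
  let e : (selmerAc W p κ 𝔭 (insert v S) ⧸
      (selmerAc W p κ 𝔭 S).addSubgroupOf (selmerAc W p κ 𝔭 (insert v S))) ≃+
      (Fin (p ^ c) → subgroupH1 (kerD κ v) (W.geomPrimaryTorsion p)) :=
    (QuotientAddGroup.quotientAddEquivOfEq hker.symm).trans
      (QuotientAddGroup.quotientKerEquivOfSurjective Ψ hsurj)
  refine ⟨⟨e⟩, ?_⟩
  have h1 : Nat.card {b : selmerAc W p κ 𝔭 (insert v S) ⧸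
      (selmerAc W p κ 𝔭 S).addSubgroupOf (selmerAc W p κ 𝔭 (insert v S)) // p • b = 0} =
      Nat.card {g : Fin (p ^ c) → subgroupH1 (kerD κ v) (W.geomPrimaryTorsion p) // p • g = 0} := by
    refine Nat.card_congr (Equiv.subtypeEquiv e.toEquiv fun b ↦ ?_)
    show p • b = 0 ↔ p • e b = 0
    rw [← map_nsmul, ← e.map_zero]
    exact e.injective.eq_iff.symm
  have h2' : Nat.card {g : Fin (p ^ c) → subgroupH1 (kerD κ v) (W.geomPrimaryTorsion p) // p • g = 0} =
      Nat.card (Fin (p ^ c) → {f : subgroupH1 (kerD κ v) (W.geomPrimaryTorsion p) // p • f = 0}) := by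
    refine Nat.card_congr
      { toFun := fun g i ↦ ⟨g.1 i, congrFun g.2 i⟩
        invFun := fun g ↦ ⟨fun i ↦ (g i).1, funext fun i ↦ (g i).2⟩
        left_inv := fun g ↦ rfl
        right_inv := fun g ↦ rfl }
  rw [h1, h2', Nat.card_fun, Nat.card_fin]


/-! ### §2 `Sel_𝔭^S(K_∞, E[p^∞])` is `p`-divisible when `Sel^S[p]` is finite, WITHOUT (iv) -/
/-- **`Sel_𝔭^S(K_∞, E[p^∞]) = p · Sel_𝔭^S`** for a finite `S` with `Sel^S[p]` finite, under the (iv)-free (L10)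
hypotheses (killing exponent at `𝔮`): `X^S` is torsion with `μ = 0` (criterion (A)), (L10)^S gives (N1)^S, so `X^S` has no
`p`-torsion and `Sel^S` is `p`-divisible. [cite: GreenbergVatsal2000, §2 Prop. (2.8)] [cite: Washington1997, §13.2]
[cite: GreenbergLNM1716, Prop. 4.14–4.15 (pp. 124–126)] -/
theorem selmerAc_divisible_of_finite_pTorsion_anyTorsion [IsTotallyComplex K]
    (hPT : poitouTate_selmerStructure_duality K)
    (hEP : ∀ v : HeightOneSpectrum (𝓞 K), localEulerPoincareCharacteristic (v.adicCompletion K))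
    {𝔭 𝔮 : HeightOneSpectrum (𝓞 K)} (h𝔭 : ((p : ℕ) : 𝓞 K) ∈ 𝔭.asIdeal)
    (h𝔮 : ((p : ℕ) : 𝓞 K) ∈ 𝔮.asIdeal) (hne : 𝔮 ≠ 𝔭)
    {m : ℕ} (htor𝔮 : ∀ Q : W.geomPrimaryTorsion p, (∀ d ∈ decomp 𝔮, d • Q = Q) → p ^ m • Q = 0)
    (hfin : Finite (selmerAcBase W p 𝔮 ∅))
    (h2 : Subsingleton (galoisCohomology (primaryGaloisModule W p) 2))
    (γ : absoluteGaloisGroup K) [hγ : Fact (κ.IsTopGenerator γ)] {S : Set (HeightOneSpectrum (𝓞 K))}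
    (hS : S.Finite) (hfinS : Set.Finite {s : selmerAc W p κ 𝔭 S | p • s = 0}) :
    ∀ s ∈ selmerAc W p κ 𝔭 S, ∃ s' ∈ selmerAc W p κ 𝔭 S, p • s' = s := by
  intro s hs
  have hT := isTorsion_of_finite_pTorsion W p κ 𝔭 S γ hS hfinS
  have hμ := muInvariant_eq_zero_of_finite_pTorsion W p κ 𝔭 S γ hS hfinS
  have hnf := XAc.forall_finite_eq_bot_of_surjective W p κ 𝔭 S γ
    (UniversalToricDescentSigmaCoinvariants.surjective_conjSelmerAc_sub_one_of_subsingleton_anyTorsion W p κ hPT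
      hEP h𝔭 h𝔮 hne htor𝔮 hfin h2 hγ.out S)
  have h0 := XAc.eq_zero_of_nsmul_eq_zero W p κ 𝔭 S γ hS hT hμ hnf
  obtain ⟨t, ht⟩ := selmerAc_divisible_of_forall W p κ 𝔭 S γ h0 ⟨s, hs⟩
  exact ⟨t, t.2, by rw [← AddSubgroupClass.coe_nsmul, ht]⟩

/-! ### §3 The product over a finite set of finitely decomposed places, WITHOUT (iv) -/

/-- **`#(Sel_𝔭^{Σ₀∪T}/Sel_𝔭^{Σ₀})[p] = ∏_{v∈T} (#H¹(H ∩ D_v, E[p^∞])[p])^{p^{c_v}}`** for a finite set `T`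
of places `v ∤ p`, `v ∉ Σ₀`, finitely decomposed in `K_∞` with exact indices `κ(D_v) = p^{c_v} ℤ_p`, under
the (iv)-free (L10) hypotheses, GIVEN that every intermediate `Sel^{Σ₀∪T′}` (`T′ ⊆ T`) is `p`-divisible: induction on
`T` with `#(L/N)[p] = #(M/N)[p] · #(L/M)[p]` (§1) and the one-place count
`natCard_quotient_pTorsion_eq_pow`. [cite: GreenbergVatsal2000, §2 Prop. (2.4) and (2.10) (pp. 24–28)] -/
theorem natCard_quotient_pTorsion_eq_prod_anyTorsion [IsTotallyComplex K]
    (hPT : poitouTate_selmerStructure_duality K)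
    (hEP : ∀ v : HeightOneSpectrum (𝓞 K), localEulerPoincareCharacteristic (v.adicCompletion K))
    {𝔭 𝔮 : HeightOneSpectrum (𝓞 K)} (h𝔭 : ((p : ℕ) : 𝓞 K) ∈ 𝔭.asIdeal)
    (h𝔮 : ((p : ℕ) : 𝓞 K) ∈ 𝔮.asIdeal) (hne : 𝔮 ≠ 𝔭)
    {m : ℕ} (htor𝔮 : ∀ Q : W.geomPrimaryTorsion p, (∀ d ∈ decomp 𝔮, d • Q = Q) → p ^ m • Q = 0)
    (hfin : Finite (selmerAcBase W p 𝔮 ∅))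
    (h2 : Subsingleton (galoisCohomology (primaryGaloisModule W p) 2))
    {γ : absoluteGaloisGroup K} (hγ : κ.IsTopGenerator γ) (S₀ : Set (HeightOneSpectrum (𝓞 K)))
    (c : HeightOneSpectrum (𝓞 K) → ℕ) (T : Finset (HeightOneSpectrum (𝓞 K)))
    (hTp : ∀ v ∈ T, ((p : ℕ) : 𝓞 K) ∉ v.asIdeal) (hTS : ∀ v ∈ T, v ∉ S₀)
    (hc : ∀ v ∈ T, ∀ z : ℤ_[p], ∃ d : decomp (K := K) v,
      (κ (d : absoluteGaloisGroup K)).toAdd = (p : ℤ_[p]) ^ c v * z)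
    (hle : ∀ v ∈ T, ∀ d : decomp (K := K) v, (p : ℤ_[p]) ^ c v ∣ (κ (d : absoluteGaloisGroup K)).toAdd)
    (hdiv : ∀ T' : Finset (HeightOneSpectrum (𝓞 K)), T' ⊆ T →
      ∀ s ∈ selmerAc W p κ 𝔭 (S₀ ∪ ↑T'), ∃ s' ∈ selmerAc W p κ 𝔭 (S₀ ∪ ↑T'), p • s' = s) :
    Nat.card {b : selmerAc W p κ 𝔭 (S₀ ∪ ↑T) ⧸
        (selmerAc W p κ 𝔭 S₀).addSubgroupOf (selmerAc W p κ 𝔭 (S₀ ∪ ↑T)) // p • b = 0} =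
      ∏ v ∈ T, Nat.card {f : subgroupH1 (kerD κ v) (W.geomPrimaryTorsion p) // p • f = 0} ^ (p ^ c v) := by
  induction T using Finset.induction_on with
  | empty =>
    rw [Finset.prod_empty, Finset.coe_empty, Set.union_empty]
    haveI : Subsingleton (selmerAc W p κ 𝔭 S₀ ⧸
        (selmerAc W p κ 𝔭 S₀).addSubgroupOf (selmerAc W p κ 𝔭 S₀)) :=
      ⟨fun a b ↦ by
        induction a using QuotientAddGroup.induction_on with | H a =>
        induction b using QuotientAddGroup.induction_on with | H b =>
        exact QuotientAddGroup.eq.mpr (AddSubgroup.mem_addSubgroupOf.mpr (-a + b).2)⟩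
    haveI : Nonempty {b : selmerAc W p κ 𝔭 S₀ ⧸
        (selmerAc W p κ 𝔭 S₀).addSubgroupOf (selmerAc W p κ 𝔭 S₀) // p • b = 0} := ⟨⟨0, smul_zero p⟩⟩
    exact Nat.card_unique
  | @insert v T hvT ih =>
    have hTsub : T ⊆ insert v T := Finset.subset_insert v T
    have ih' := ih (fun w hw ↦ hTp w (hTsub hw)) (fun w hw ↦ hTS w (hTsub hw))
      (fun w hw ↦ hc w (hTsub hw)) (fun w hw ↦ hle w (hTsub hw))
      (fun T' hT' ↦ hdiv T' (hT'.trans hTsub))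
    have hvS : v ∉ S₀ ∪ ↑T := by
      rintro (h | h)
      · exact hTS v (Finset.mem_insert_self v T) h
      · exact hvT (Finset.mem_coe.mp h)
    rw [Finset.prod_insert hvT, Finset.coe_insert, Set.union_insert]
    -- `N = Sel^{S₀} ≤ M = Sel^{S₀ ∪ T} ≤ L = Sel^{(S₀ ∪ T) ∪ {v}}`
    have hNM : selmerAc W p κ 𝔭 S₀ ≤ selmerAc W p κ 𝔭 (S₀ ∪ ↑T) := selmerOver_mono Set.subset_union_left
    have hML : selmerAc W p κ 𝔭 (S₀ ∪ ↑T) ≤ selmerAc W p κ 𝔭 (insert v (S₀ ∪ ↑T)) :=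
      selmerOver_mono (Set.subset_insert _ _)
    have h3 := natCard_quotTorsion_eq_mul_of_divisible (selmerAc W p κ 𝔭 S₀)
      (selmerAc W p κ 𝔭 (S₀ ∪ ↑T)) (selmerAc W p κ 𝔭 (insert v (S₀ ∪ ↑T))) hNM hML p (hdiv T hTsub)
    have hcount := (natCard_quotient_pTorsion_eq_pow_anyTorsion W p κ hPT hEP h𝔭 h𝔮 hne htor𝔮 hfin h2 hγ
      (S := S₀ ∪ ↑T) (hTp v (Finset.mem_insert_self v T)) hvS (hc v (Finset.mem_insert_self v T))
      (hle v (Finset.mem_insert_self v T))).2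
    rw [h3, ih', hcount, mul_comm]

/-- **`#(Sel_𝔭^{Σ₀∪T}/Sel_𝔭^{Σ₀})[p] = ∏_{v∈T} (#H¹(H ∩ D_v, E[p^∞])[p])^{p^{c_v}}` with the divisibility
DISCHARGED**: same data, `Σ₀` finite, and `Sel^{Σ₀∪T}[p]` finite (e.g. `X^{Σ₀∪T}` torsion with `μ = 0`,
`finite_pTorsion_of_muInvariant_eq_zero`) — every intermediate `Sel^{Σ₀∪T′}` then has finite `p`-torsion
and is `p`-divisible by §2. With `Σ₀ = ∅`, `T = Σ` this is Greenberg–Vatsal's (2.10) for the finite group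
`B^Σ[p]` of the `Σ`-free transport. [cite: GreenbergVatsal2000, §2 Prop. (2.4), (2.8) and (2.10) (pp. 24–28)]
[cite: Washington1997, §13.2] -/
theorem natCard_quotient_pTorsion_eq_prod_of_finite_anyTorsion [IsTotallyComplex K]
    (hPT : poitouTate_selmerStructure_duality K)
    (hEP : ∀ v : HeightOneSpectrum (𝓞 K), localEulerPoincareCharacteristic (v.adicCompletion K))
    {𝔭 𝔮 : HeightOneSpectrum (𝓞 K)} (h𝔭 : ((p : ℕ) : 𝓞 K) ∈ 𝔭.asIdeal)
    (h𝔮 : ((p : ℕ) : 𝓞 K) ∈ 𝔮.asIdeal) (hne : 𝔮 ≠ 𝔭)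
    {m : ℕ} (htor𝔮 : ∀ Q : W.geomPrimaryTorsion p, (∀ d ∈ decomp 𝔮, d • Q = Q) → p ^ m • Q = 0)
    (hfin : Finite (selmerAcBase W p 𝔮 ∅))
    (h2 : Subsingleton (galoisCohomology (primaryGaloisModule W p) 2))
    (γ : absoluteGaloisGroup K) [hγ : Fact (κ.IsTopGenerator γ)] {S₀ : Set (HeightOneSpectrum (𝓞 K))}
    (hS₀ : S₀.Finite) (c : HeightOneSpectrum (𝓞 K) → ℕ) (T : Finset (HeightOneSpectrum (𝓞 K)))
    (hTp : ∀ v ∈ T, ((p : ℕ) : 𝓞 K) ∉ v.asIdeal) (hTS : ∀ v ∈ T, v ∉ S₀)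
    (hc : ∀ v ∈ T, ∀ z : ℤ_[p], ∃ d : decomp (K := K) v,
      (κ (d : absoluteGaloisGroup K)).toAdd = (p : ℤ_[p]) ^ c v * z)
    (hle : ∀ v ∈ T, ∀ d : decomp (K := K) v, (p : ℤ_[p]) ^ c v ∣ (κ (d : absoluteGaloisGroup K)).toAdd)
    (hfinT : Set.Finite {s : selmerAc W p κ 𝔭 (S₀ ∪ ↑T) | p • s = 0}) :
    Nat.card {b : selmerAc W p κ 𝔭 (S₀ ∪ ↑T) ⧸
        (selmerAc W p κ 𝔭 S₀).addSubgroupOf (selmerAc W p κ 𝔭 (S₀ ∪ ↑T)) // p • b = 0} =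
      ∏ v ∈ T, Nat.card {f : subgroupH1 (kerD κ v) (W.geomPrimaryTorsion p) // p • f = 0} ^ (p ^ c v) :=
  natCard_quotient_pTorsion_eq_prod_anyTorsion W p κ hPT hEP h𝔭 h𝔮 hne htor𝔮 hfin h2 hγ.out S₀ c T hTp hTS hc
    hle fun T' hT' ↦ selmerAc_divisible_of_finite_pTorsion_anyTorsion W p κ hPT hEP h𝔭 h𝔮 hne htor𝔮 hfin h2 γ
      (hS₀.union T'.finite_toSet)
      (finite_selmerAc_pTorsion_of_subset W p κ
        (Set.union_subset_union_right S₀ (Finset.coe_subset.mpr hT')) hfinT)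

end Selmer

/-! ### §4 The route's instance: `E/ℚ` over an imaginary quadratic `K` with `p` split, NO (iv) -/

section Route

/-- **`#(Sel_𝔭^Σ(K_∞, E[p^∞]) / Sel_𝔭^∅)[p] = ∏_{v∈Σ} (#H¹(H ∩ D_v, E[p^∞])[p])^{p^{c_v}}` WITHOUT (iv)** for `E/ℚ`,
`K` imaginary quadratic with `p` split, ANY `ℤ_p`-extension `κ` with topological generator `γ`, a degree-one
`𝔭 ∋ p` as the strict place, `Sel_v(K, E[p^∞])` finite at every `v ∣ p`, a finite `Σ` of places `v ∤ p` with exact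
indices `κ(D_v) = p^{c_v} ℤ_p`, and `Sel^Σ[p]` finite — GIVEN the two cited Poitou–Tate facts. g8's
`natCard_quotient_pTorsion_baseChange_eq_prod_of_noPTorsionPadic` minus `h4` (`H²(K, E[p^∞]) = 0` from
`subsingleton_galoisCohomology_two_primary_anyTorsion`, killing exponent at the conjugate prime from
`exists_pow_nsmul_fixedPoints_decomp_eq_zero`). [cite: GreenbergVatsal2000, §2 Cor. (2.3), Prop. (2.4) and (2.10) (pp. 24–28)]
[cite: JetchevSkinnerWan2017, Prop. 3.3.2 and Lemma 3.3.3 (arXiv:1512.06894 pp. 11–12)] [cite: MilneADT2006, Ch. I, Thm. 4.10] -/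
theorem natCard_quotient_pTorsion_baseChange_eq_prod_anyTorsion
    (W : WeierstrassCurve ℚ) [W.IsElliptic] [W.IsGloballyMinimal] (p : ℕ) [Fact p.Prime]
    {K : Type} [Field K] [NumberField K]
    (hPT : poitouTate_selmerStructure_duality K) (hPT2 : poitouTate_sha_tateDual K)
    (hK : IsImaginaryQuadratic K) (hsplit : SplitsIn K p)
    (κ : ZpExtension K p) (γ : absoluteGaloisGroup K) [hγ : Fact (κ.IsTopGenerator γ)]
    {𝔭 : HeightOneSpectrum (𝓞 K)} (h𝔭 : ((p : ℕ) : 𝓞 K) ∈ 𝔭.asIdeal)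
    (hfin : ∀ v : HeightOneSpectrum (𝓞 K), ((p : ℕ) : 𝓞 K) ∈ v.asIdeal →
      Finite (selmerAcBase (W.baseChange K) p v ∅))
    {S : Set (HeightOneSpectrum (𝓞 K))} (hS : S.Finite)
    (hSp : ∀ v ∈ S, ((p : ℕ) : 𝓞 K) ∉ v.asIdeal) (c : HeightOneSpectrum (𝓞 K) → ℕ)
    (hc : ∀ v ∈ S, ∀ z : ℤ_[p], ∃ d : decomp (K := K) v,
      (κ (d : absoluteGaloisGroup K)).toAdd = (p : ℤ_[p]) ^ c v * z)
    (hle : ∀ v ∈ S, ∀ d : decomp (K := K) v, (p : ℤ_[p]) ^ c v ∣ (κ (d : absoluteGaloisGroup K)).toAdd)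
    (hfinS : Set.Finite {s : selmerAc (W.baseChange K) p κ 𝔭 S | p • s = 0}) :
    Nat.card {b : selmerAc (W.baseChange K) p κ 𝔭 S ⧸
        (selmerAc (W.baseChange K) p κ 𝔭 ∅).addSubgroupOf (selmerAc (W.baseChange K) p κ 𝔭 S) //
          p • b = 0} =
      ∏ v ∈ hS.toFinset, Nat.card {f : subgroupH1 (kerD κ v) ((W.baseChange K).geomPrimaryTorsion p) //
        p • f = 0} ^ (p ^ c v) := by
  haveI : IsTotallyComplex K := hK.2
  haveI hEK : (W.baseChange K).IsElliptic := by rw [WeierstrassCurve.baseChange]; infer_instance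
  obtain ⟨σ, 𝔮, -, hne, h𝔮, -⟩ :=
    LocalIndexTransport.exists_conj_prime_of_splitsIn K p hK.1 hsplit h𝔭
  have htor := exists_pow_nsmul_local_eq_zero W p hK.1 hsplit
  haveI := hfin 𝔭 h𝔭
  have h2 := subsingleton_galoisCohomology_two_primary_anyTorsion (W.baseChange K) p 𝔭 ∅ hPT2
    (fieldCdLE_two_of_isTotallyComplex fieldCdLE_two_of_numberField_holds K p) htor
  obtain ⟨he𝔮, hf𝔮⟩ := degreeOne_of_splitsIn hK.1 hsplit h𝔮
  obtain ⟨m, hm⟩ := exists_pow_nsmul_fixedPoints_decomp_eq_zero W p 𝔮 h𝔮 he𝔮 hf𝔮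
  -- the product theorem at `Σ₀ = ∅`, `T = Σ`, stated for any `S' = ∅ ∪ Σ`
  have key : ∀ S' : Set (HeightOneSpectrum (𝓞 K)), S' = ∅ ∪ (hS.toFinset : Set (HeightOneSpectrum (𝓞 K))) →
      Set.Finite {s : selmerAc (W.baseChange K) p κ 𝔭 S' | p • s = 0} →
      Nat.card {b : selmerAc (W.baseChange K) p κ 𝔭 S' ⧸
          (selmerAc (W.baseChange K) p κ 𝔭 ∅).addSubgroupOf (selmerAc (W.baseChange K) p κ 𝔭 S') //
            p • b = 0} =
        ∏ v ∈ hS.toFinset, Nat.card {f : subgroupH1 (kerD κ v) ((W.baseChange K).geomPrimaryTorsion p) //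
          p • f = 0} ^ (p ^ c v) := by
    rintro S' rfl hfinS'
    exact natCard_quotient_pTorsion_eq_prod_of_finite_anyTorsion (W.baseChange K) p κ hPT
      (fun v ↦ GaloisImage.EP.localEulerPoincareCharacteristic_adicCompletion K v) h𝔭 h𝔮 hne hm
      (hfin 𝔮 h𝔮) h2 γ Set.finite_empty c hS.toFinset
      (fun v hv ↦ hSp v (hS.mem_toFinset.mp hv)) (fun v _ h ↦ h)
      (fun v hv ↦ hc v (hS.mem_toFinset.mp hv)) (fun v hv ↦ hle v (hS.mem_toFinset.mp hv)) hfinS'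
  have e : S = ∅ ∪ (hS.toFinset : Set (HeightOneSpectrum (𝓞 K))) := by
    rw [Set.empty_union, hS.coe_toFinset]
  exact key S e (by exact hfinS)

end Route

end Summit.BirchSwinnertonDyer.BirchSwinnertonDyer.Theorems.UniversalToricDescentSigmaLocalImage

end
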